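import Literature.NumberTheory.EllipticCurves.KernelReductionDivisibleProofs
import Literature.NumberTheory.EllipticCurves.ReductionHomomorphismCuspNodeProofs
import Literature.NumberTheory.EllipticCurves.VariableChangePointsMap
import Mathlib.RingTheory.Henselian
import Mathlib.RingTheory.Valuation.Integral
import Mathlib.FieldTheory.IsAlgClosed.Basic
import HarnessLib

/-!
# The valuation ring of an algebraically closed valued field is henselian with algebraically
# closed residue field; inertia acts trivially on reductions (Serre–Tate, §1, setting of Lemma 2)

`Proofs` file (theorems only, no definitions, no named facts) in topic
`NumberTheory/EllipticCurves`, landed by the tenured seat of bsd.S15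
(`Literature.NumberTheory.EllipticCurves.conductorNorm_eq_artinConductorNat`, `BSDConductor`) as a
bottom-up step below the two bad-place cases of Silverman *ATAEC* Thm. IV.10.2(a)
(`WeierstrassCurve.codimFixed_inertia_rationalTate_eq_one_of_hasMultiplicativeReductionAt`,
`…_eq_two_of_hasAdditiveReductionAt`, `HasseWeilAbelianConductor`), whose printed proof (PDF
p. 359 of the held copy, "taken from Serre–Tate [1]") runs through the reduction sequence
`0 → E₁(K^nr) → E₀(K^nr) → Ẽ_ns(k̄) → 0` over the maximal unramified extension.  The tree renders
the local objects inside `K̄_v` with its spectral valuation `w : Valuation K̄_v ℝ≥0`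
(`SelmerFiniteProofs`, `KodairaNeronUnramified`), and the reduction theory of *AEC* VII.2.1 for a
Weierstrass equation `W₀` over the valuation ring `w.integer` (`ReductionHomomorphism`,
`…SurjectiveProofs`, `…CuspNodeProofs`).  This file supplies three ingredients of that rendering
which do not involve the curve `E/K` itself:

* `Literature.NumberTheory.EllipticCurves.henselianLocalRing_integer`,
  `henselianRing_integer` — **the valuation ring `𝒪_w` of an algebraically closed valued field
  `(L, w)` is henselian** (a monic `f ∈ 𝒪_w[X]` with a root `ā₀` of its reduction has a root
  `a ≡ a₀`: `f` splits in `L`, its roots are `w`-integral; in the tree this is the lifting lemma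
  `exists_root_val_sub_lt_one` of `KernelReductionDivisibleProofs`), so that the surjectivity of
  reduction `E₀(L) → Ẽ_ns(k)` of *AEC* VII.2.1 (`reductionHom_surjective`,
  `exists_addMonoidHom_units_of_node_of_isAlgClosed`) is available over `L = K̄_v`;
* `Literature.NumberTheory.EllipticCurves.isAlgClosed_residueField_integer` — **its residue field
  `k = 𝒪_w/𝔪_w` is algebraically closed** (lift a monic polynomial, take a root in `L`, it is
  integral, reduce), so that `Ẽ_ns(k) ≅ kˣ`, resp. `k⁺`, at a node, resp. cusp (*AEC* III.2.5)
  and `rank T_ℓ(kˣ) = 1` (`finrank_tateModule_additive_units`);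
* `WeierstrassCurve.reducePoint_congrEquiv_map_eq`,
  `WeierstrassCurve.hasNonsingularReduction_congrEquiv_map_iff`,
  `WeierstrassCurve.reducesToZero_congrEquiv_map_iff` — **inertia acts trivially on the
  reduction**: for a Weierstrass equation `X` over a subfield `F₀ ⊆ L` with
  `X_L = (W₀)_L` and an `F₀`-automorphism `σ` of `L` which is a `w`-isometry moving `w`-integers
  by elements of `𝔪_w` (`w (σ z - z) < 1` for `w z ≤ 1` — the valuation-theoretic description of
  the inertia group, Neukirch *ANT* II (9.3); tree `mem_inertia_iff_spectralValuation`), the point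
  `P^σ` has the same reduction as `P`, lies in `E₀` iff `P` does and in `E₁` iff `P` does
  (Silverman *AEC* VII.§2 and VIII.§1: "inertia acts trivially on `Ẽ`"; the transport
  `X_L(L) = (W₀)_L(L)` is the identity on coordinates, `Affine.Point.congrEquiv`).

All axioms `propext`, `Classical.choice`, `Quot.sound`.

## References

* J.-P. Serre, J. Tate, *Good reduction of abelian varieties*, Ann. of Math. 88 (1968), §1,
  Lemmas 1–2 (reduction over the strict henselisation). [SerreTate1968]
* J. H. Silverman, *The Arithmetic of Elliptic Curves*, 2nd ed. (2009), VII.2 Prop. 2.1 (and its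
  proof, Hensel's lemma), III.2.5, VIII.§1. [SilvermanAEC2009]
* J. H. Silverman, *Advanced Topics in the Arithmetic of Elliptic Curves*, GTM 151 (1994), proof
  of Thm. IV.10.2(a) (PDF p. 359). [SilvermanATAEC1994]
* J. Neukirch, *Algebraic Number Theory* (1999), Ch. II (6.2), §9 (9.3). [NeukirchANT1999]

## Design

No definitions; `noncomputable section`; `open scoped Classical NNReal`; one universe `u` for the
valued field `L` (as in `GoodReductionInertia`, `KernelReductionDivisibleProofs`).  The henselian
property is recorded both as Mathlib's `HenselianLocalRing` and as `HenselianRing _ (maximalIdeal _)`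
(the hypothesis of `ReductionHomomorphismSurjectiveProofs`); both are theorems to be introduced
with `haveI`, no global instance is declared.
-/

noncomputable section

open scoped Classical NNReal
open Polynomial

universe u

namespace Literature.NumberTheory.EllipticCurves

variable {L : Type u} [Field L] (w : Valuation L ℝ≥0)

/-! ### The valuation ring of an algebraically closed valued field -/

/-- Roots in `L` of a monic polynomial over the valuation ring `𝒪_w` are `w`-integral (`𝒪_w` is
integrally closed in `L`, Mathlib `Valuation.Integers.mem_of_integral`). [folklore] -/
theorem mem_integer_of_isRoot_map_of_monic {q : (w.integer)[X]} (hq : q.Monic) {α : L}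
    (hα : (q.map (algebraMap w.integer L)).IsRoot α) : α ∈ w.integer := by
  have hv : w.Integers w.integer := Valuation.integer.integers w
  refine hv.mem_of_integral ⟨q, hq, ?_⟩
  rwa [IsRoot.def, eval_map] at hα

/-- Evaluation commutes with the inclusion `𝒪_w ⊆ L`: `f_L(a) = f(a)` for `a ∈ 𝒪_w`. [folklore] -/
theorem eval_map_algebraMap_integer (f : (w.integer)[X]) (a : w.integer) :
    (f.map (algebraMap w.integer L)).eval (a : L) = algebraMap w.integer L (f.eval a) := by
  rw [eval_map, show (a : L) = algebraMap w.integer L a from rfl, eval₂_at_apply]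

variable [IsAlgClosed L]

/-- **The valuation ring of an algebraically closed valued field is henselian** (as a local
ring: every monic `f ∈ 𝒪_w[X]` and `a₀ ∈ 𝒪_w` with `f(a₀) ∈ 𝔪_w` admit a root `a ∈ 𝒪_w` of `f`
with `a - a₀ ∈ 𝔪_w`; the simple-root hypothesis of Hensel's lemma is not even needed).  Proof:
`f_L` has `w`-integral coefficients and unit leading coefficient, so the lifting lemma
`exists_root_val_sub_lt_one` (`KernelReductionDivisibleProofs`: over an algebraically closed
valued field every approximate integral root of an integral polynomial refines to an exact one)
gives a root `s` with `w s ≤ 1`, `w (s - a₀) < 1`.  Neukirch, *ANT*, II §6 (henselian fields;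
an algebraically closed valued field is trivially henselian). [folklore] -/
theorem henselianLocalRing_integer : HenselianLocalRing w.integer where
  is_henselian f hf a₀ h₀ _ := by
    have hv : w.Integers w.integer := Valuation.integer.integers w
    set H : L[X] := f.map (algebraMap w.integer L) with hH
    have hint : ∀ i, w (H.coeff i) ≤ 1 := fun i ↦ by
      rw [hH, coeff_map]; exact (f.coeff i).2
    have hunit : ∃ i, w (H.coeff i) = 1 := ⟨f.natDegree, by
      rw [hH, coeff_map, coeff_natDegree, hf.leadingCoeff, map_one, map_one]⟩
    have hdeg : H.natDegree ≤ f.natDegree := natDegree_map_le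
    have hs₀ : w (a₀ : L) ≤ 1 := a₀.2
    have hHs₀ : w (H.eval (a₀ : L)) < 1 := by
      rw [hH, eval_map_algebraMap_integer]
      exact (v_algebraMap_lt_one_iff hv _).mpr ((IsLocalRing.residue_eq_zero_iff _).mpr h₀)
    obtain ⟨s, hs1, hss₀, hroot⟩ :=
      exists_root_val_sub_lt_one (w := w) f.natDegree H hdeg hint hunit a₀ hs₀ hHs₀
    refine ⟨⟨s, hs1⟩, ?_, ?_⟩
    · rw [IsRoot.def]
      apply hv.hom_inj
      rw [map_zero, ← eval_map_algebraMap_integer, ← hH]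
      exact hroot
    · rw [← IsLocalRing.residue_eq_zero_iff, ← v_algebraMap_lt_one_iff hv]
      exact hss₀

/-- The valuation ring of an algebraically closed valued field is henselian at its maximal ideal
(Mathlib `HenselianRing`, the hypothesis of `WeierstrassCurve.reductionHom_surjective` and
`exists_addMonoidHom_units_of_node_of_isAlgClosed`). [folklore] -/
theorem henselianRing_integer :
    HenselianRing w.integer (IsLocalRing.maximalIdeal w.integer) :=
  haveI := henselianLocalRing_integer w
  inferInstance

/-- **The residue field of the valuation ring of an algebraically closed valued field is
algebraically closed**: a monic `p ∈ k[X]` of positive degree lifts to a monic `q ∈ 𝒪_w[X]`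
(Mathlib `lifts_and_natDegree_eq_and_monic`), `q_L` has a root `α ∈ L`, which is `w`-integral
(`mem_integer_of_isRoot_map_of_monic`), and `ᾱ` is a root of `p`.  (For `L = K̄_v` this is
"the residue field of `K̄_v` is `k̄_v`", Neukirch, *ANT*, II §6–§9.) [folklore] -/
theorem isAlgClosed_residueField_integer :
    IsAlgClosed (IsLocalRing.ResidueField w.integer) := by
  have hv : w.Integers w.integer := Valuation.integer.integers w
  refine IsAlgClosed.of_exists_root _ fun p hp hirr ↦ ?_
  obtain ⟨q, hqp, hdeg, hq⟩ := lifts_and_natDegree_eq_and_monic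
    (map_surjective _ IsLocalRing.residue_surjective p) hp
  have hQdeg : (q.map (algebraMap w.integer L)).degree ≠ 0 := by
    rw [degree_map_eq_of_injective hv.hom_inj, degree_eq_natDegree hq.ne_zero, hdeg,
      ← degree_eq_natDegree hp.ne_zero]
    exact (degree_pos_of_irreducible hirr).ne'
  obtain ⟨α, hα⟩ := IsAlgClosed.exists_root _ hQdeg
  have hαint : α ∈ w.integer := mem_integer_of_isRoot_map_of_monic w hq hα
  refine ⟨IsLocalRing.residue w.integer ⟨α, hαint⟩, ?_⟩
  have hq0 : q.eval ⟨α, hαint⟩ = 0 := by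
    apply hv.hom_inj
    rw [map_zero, ← eval_map_algebraMap_integer]
    exact hα
  rw [← hqp, eval_map, show (IsLocalRing.residue w.integer ⟨α, hαint⟩) =
    (IsLocalRing.residue w.integer) ⟨α, hαint⟩ from rfl, eval₂_at_apply, hq0, map_zero]

end Literature.NumberTheory.EllipticCurves

/-! ### Inertia acts trivially on the reduction -/

namespace WeierstrassCurve

open Literature.NumberTheory.EllipticCurves

variable {L : Type u} [Field L] {w : Valuation L ℝ≥0} (W₀ : WeierstrassCurve w.integer)

/-- Two `w`-integers differing by an element of `𝔪_w` have the same residue. [folklore] -/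
theorem residue_eq_of_val_sub_lt_one {x x' : L} (hx : w x ≤ 1) (hx' : w x' ≤ 1)
    (h : w (x' - x) < 1) :
    IsLocalRing.residue w.integer ⟨x', hx'⟩ = IsLocalRing.residue w.integer ⟨x, hx⟩ := by
  have hv : w.Integers w.integer := Valuation.integer.integers w
  rw [← sub_eq_zero, ← map_sub, ← v_algebraMap_lt_one_iff hv]
  exact h

section Coordinates

variable {x y x' y' : L}

/-- **Same reduction for `w`-congruent points.**  On a Weierstrass equation `W₀` over `𝒪_w`, two
points `(x, y)`, `(x', y')` with `w x' = w x` and with `x' ≡ x`, `y' ≡ y (mod 𝔪_w)` whenever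
`x`, resp. `y`, is `w`-integral, have the same reduction (`WeierstrassCurve.reducePoint`: both
`Õ` if `x ∉ 𝒪_w`; otherwise `(x̄, ȳ) = (x̄', ȳ')`, nonsingular or not together).
Silverman, *AEC*, VII.§2. [folklore] -/
theorem reducePoint_some_eq_of_val {h : (W₀.baseChange L).toAffine.Nonsingular x y}
    {h' : (W₀.baseChange L).toAffine.Nonsingular x' y'} (hxv : w x' = w x)
    (hxd : w x ≤ 1 → w (x' - x) < 1) (hyd : w y ≤ 1 → w (y' - y) < 1) :
    W₀.reducePoint (.some x' y' h') = W₀.reducePoint (.some x y h) := by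
  have hv : w.Integers w.integer := Valuation.integer.integers w
  by_cases hx : w x ≤ 1
  · have hy : w y ≤ 1 := v_Y_le_one_of_v_X_le_one hv h.1 hx
    have hx' : w x' ≤ 1 := hxv ▸ hx
    have hy' : w y' ≤ 1 := v_Y_le_one_of_v_X_le_one hv h'.1 hx'
    have hrx := residue_eq_of_val_sub_lt_one hx hx' (hxd hx)
    have hry := residue_eq_of_val_sub_lt_one hy hy' (hyd hy)
    have hh : (W₀.baseChange L).toAffine.Nonsingular (algebraMap w.integer L ⟨x, hx⟩)
        (algebraMap w.integer L ⟨y, hy⟩) := h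
    have hh' : (W₀.baseChange L).toAffine.Nonsingular (algebraMap w.integer L ⟨x', hx'⟩)
        (algebraMap w.integer L ⟨y', hy'⟩) := h'
    change W₀.reducePoint (.some _ _ hh') = W₀.reducePoint (.some _ _ hh)
    by_cases hns : (W₀.map (IsLocalRing.residue w.integer)).toAffine.Nonsingular
        (IsLocalRing.residue w.integer ⟨x, hx⟩) (IsLocalRing.residue w.integer ⟨y, hy⟩)
    · have hns' : (W₀.map (IsLocalRing.residue w.integer)).toAffine.Nonsingular
          (IsLocalRing.residue w.integer ⟨x', hx'⟩) (IsLocalRing.residue w.integer ⟨y', hy'⟩) := by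
        rw [hrx, hry]; exact hns
      rw [reducePoint_some_algebraMap hv.hom_inj hh' hns', reducePoint_some_algebraMap hv.hom_inj hh hns]
      exact point_some_congr hrx hry
    · have hns' : ¬ (W₀.map (IsLocalRing.residue w.integer)).toAffine.Nonsingular
          (IsLocalRing.residue w.integer ⟨x', hx'⟩) (IsLocalRing.residue w.integer ⟨y', hy'⟩) := by
        rw [hrx, hry]; exact hns
      rw [reducePoint_some_algebraMap_of_not hv.hom_inj hh' hns',
        reducePoint_some_algebraMap_of_not hv.hom_inj hh hns]
  · have hx1 : 1 < w x := not_le.mp hx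
    have hx1' : 1 < w x' := hxv ▸ hx1
    rw [reducePoint_some_of_not_mem h' ((not_mem_range_iff hv).mpr hx1'),
      reducePoint_some_of_not_mem h ((not_mem_range_iff hv).mpr hx1)]

/-- `w`-congruent points lie in `E₀` together (`WeierstrassCurve.HasNonsingularReduction`).
Silverman, *AEC*, VII.§2. [folklore] -/
theorem hasNonsingularReduction_some_iff_of_val {h : (W₀.baseChange L).toAffine.Nonsingular x y}
    {h' : (W₀.baseChange L).toAffine.Nonsingular x' y'} (hxv : w x' = w x)
    (hxd : w x ≤ 1 → w (x' - x) < 1) (hyd : w y ≤ 1 → w (y' - y) < 1) :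
    W₀.HasNonsingularReduction (.some x' y' h') ↔ W₀.HasNonsingularReduction (.some x y h) := by
  have hv : w.Integers w.integer := Valuation.integer.integers w
  by_cases hx : w x ≤ 1
  · have hy : w y ≤ 1 := v_Y_le_one_of_v_X_le_one hv h.1 hx
    have hx' : w x' ≤ 1 := hxv ▸ hx
    have hy' : w y' ≤ 1 := v_Y_le_one_of_v_X_le_one hv h'.1 hx'
    have hrx := residue_eq_of_val_sub_lt_one hx hx' (hxd hx)
    have hry := residue_eq_of_val_sub_lt_one hy hy' (hyd hy)
    have hh : (W₀.baseChange L).toAffine.Nonsingular (algebraMap w.integer L ⟨x, hx⟩)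
        (algebraMap w.integer L ⟨y, hy⟩) := h
    have hh' : (W₀.baseChange L).toAffine.Nonsingular (algebraMap w.integer L ⟨x', hx'⟩)
        (algebraMap w.integer L ⟨y', hy'⟩) := h'
    change W₀.HasNonsingularReduction (.some _ _ hh') ↔ W₀.HasNonsingularReduction (.some _ _ hh)
    rw [hasNonsingularReduction_some_algebraMap_iff hv.hom_inj hh',
      hasNonsingularReduction_some_algebraMap_iff hv.hom_inj hh, hrx, hry]
  · have hx1 : 1 < w x := not_le.mp hx
    have hx1' : 1 < w x' := hxv ▸ hx1
    exact ⟨fun _ ↦ Or.inl ((not_mem_range_iff hv).mpr hx1),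
      fun _ ↦ Or.inl ((not_mem_range_iff hv).mpr hx1')⟩

omit W₀ in
/-- Points with `w x' = w x` lie in `E₁` together (`WeierstrassCurve.ReducesToZero`: `x ∉ 𝒪_w`).
Silverman, *AEC*, VII.§2. [folklore] -/
theorem reducesToZero_some_iff_of_val {W₀ : WeierstrassCurve w.integer}
    {h : (W₀.baseChange L).toAffine.Nonsingular x y}
    {h' : (W₀.baseChange L).toAffine.Nonsingular x' y'} (hxv : w x' = w x) :
    W₀.ReducesToZero (.some x' y' h') ↔ W₀.ReducesToZero (.some x y h) := by
  have hv : w.Integers w.integer := Valuation.integer.integers w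
  rw [reducesToZero_some_iff, reducesToZero_some_iff, not_mem_range_iff hv, not_mem_range_iff hv,
    hxv]

end Coordinates

/-! ### The same along a transport `X_L = (W₀)_L` and an automorphism `σ` of `L` -/

section Transport

variable {F₀ : Type*} [Field F₀] [Algebra F₀ L] {X : WeierstrassCurve F₀}
  (hX : X.baseChange L = W₀.baseChange L) (σ : L →ₐ[F₀] L)
  (hσ₁ : ∀ z, w (σ z) = w z) (hσ₂ : ∀ z, w z ≤ 1 → w (σ z - z) < 1)
include hσ₁ hσ₂

/-- **Inertia acts trivially on the reduction.**  Let `X` be a Weierstrass equation over a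
subfield `F₀ ⊆ L` with `X_L = (W₀)_L` for an `𝒪_w`-equation `W₀`, and `σ` an `F₀`-endomorphism
of `L` which is a `w`-isometry moving `w`-integers within their residue class (the elements of
the inertia group, Neukirch *ANT* II (9.3)).  Then `P^σ` and `P` have the same reduction on `W₀`
(transport by the identity on coordinates, `Affine.Point.congrEquiv`).  Silverman, *AEC*,
VIII.§1 ("the inertia group acts trivially on `Ẽ`").
[cite: SilvermanAEC2009, VIII.§1 and VII.§2 (reduction and the action of inertia)] -/
theorem reducePoint_congrEquiv_map_eq (P : (X.baseChange L).toAffine.Point) :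
    W₀.reducePoint (Affine.Point.congrEquiv hX (Affine.Point.map σ P)) =
      W₀.reducePoint (Affine.Point.congrEquiv hX P) := by
  rcases P with _ | ⟨x, y, h⟩
  · rw [← Affine.Point.zero_def, map_zero]
  · rw [Affine.Point.map_some, Affine.Point.congrEquiv_some, Affine.Point.congrEquiv_some]
    exact W₀.reducePoint_some_eq_of_val (hσ₁ x) (fun hx ↦ hσ₂ x hx) (fun hy ↦ hσ₂ y hy)

/-- Under the same hypotheses, `P^σ ∈ E₀ ↔ P ∈ E₀`. [cite: SilvermanAEC2009, VIII.§1 and VII.§2 (reduction and the action of inertia)] -/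
theorem hasNonsingularReduction_congrEquiv_map_iff (P : (X.baseChange L).toAffine.Point) :
    W₀.HasNonsingularReduction (Affine.Point.congrEquiv hX (Affine.Point.map σ P)) ↔
      W₀.HasNonsingularReduction (Affine.Point.congrEquiv hX P) := by
  rcases P with _ | ⟨x, y, h⟩
  · rw [← Affine.Point.zero_def, map_zero]
  · rw [Affine.Point.map_some, Affine.Point.congrEquiv_some, Affine.Point.congrEquiv_some]
    exact W₀.hasNonsingularReduction_some_iff_of_val (hσ₁ x) (fun hx ↦ hσ₂ x hx)
      (fun hy ↦ hσ₂ y hy)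

omit hσ₂ in
/-- Under the same hypotheses (isometry suffices), `P^σ ∈ E₁ ↔ P ∈ E₁`. [cite: SilvermanAEC2009, VIII.§1 and VII.§2 (reduction and the action of inertia)] -/
theorem reducesToZero_congrEquiv_map_iff (P : (X.baseChange L).toAffine.Point) :
    W₀.ReducesToZero (Affine.Point.congrEquiv hX (Affine.Point.map σ P)) ↔
      W₀.ReducesToZero (Affine.Point.congrEquiv hX P) := by
  rcases P with _ | ⟨x, y, h⟩
  · rw [← Affine.Point.zero_def, map_zero]
  · rw [Affine.Point.map_some, Affine.Point.congrEquiv_some, Affine.Point.congrEquiv_some]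
    exact reducesToZero_some_iff_of_val (hσ₁ x)

end Transport

end WeierstrassCurve

end
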